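import Summits.BirchSwinnertonDyer.BirchSwinnertonDyer.Theorems.GenusKolyvaginAtTwoOffCutResidualAtTwoRLw2PhantomExclusionKLW
import Summits.BirchSwinnertonDyer.BirchSwinnertonDyer.Theorems.GenusKolyvaginAtTwoEquivariantKolyvaginExactAtTwoSelmerDescentSplit
import Summits.BirchSwinnertonDyer.BirchSwinnertonDyer.Theorems.GenusKolyvaginAtTwoPowDvdShaCardAtTwoRTLocalDegreeQuadratic
import Literature.NumberTheory.EllipticCurves.AnticyclotomicHeegnerPlacesDecompositionProofs
import Literature.AnabelianGeometry.AbsoluteAnabelian.NeukirchUchidaLocalInvariantsOmega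
import HarnessLib

/-!
# Route `GenusKolyvaginAtTwo`, residual `OffCutResidualAtTwoR` (stmt-BirchSwinnertonDyer-31767), LINE 26 «lw2_phantom_exclusion»,
# THE LEVEL-2 WITNESS: STUB `stub_transport` (a witness place `v ∣ N` of `ℚ` gives a witness place `w₀ ∣ v` of the Heegner field) and
# EXACTNESS OF THE LEVER (`(NPh_M)` for every `M ≥ 1` ⟺ `(NPh_2)` ⟺ a level-2 witness place over `2N` exists)

Width seat `bsd-line-gk2-p4` g31 (cell `bsd-f1-sign2`), `--supports stmt-BirchSwinnertonDyer-31767 --as helper`.  THEOREMS ONLY (no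
definition, no named fact, no `sorry`).  **BSD is NOT proved by this file; nothing is closed by it alone.**

WHAT.  LINE 26's decidable per-curve predicate `LW₂(W)` is a witness OVER `ℚ`: a place `v ∣ N` at which no non-zero class of
`H¹(ℚ, E[2])` dying on `Γ_{ℚ(E[4])}` (the Lawson–Wuthrich class `ξ = [−Δ·F′(e)]`, g10 `…TwistingPrimeLevelFourClass`) is Kummer.  The lever
`stub_KLW` (this seat's `…Lw2PhantomExclusionKLW`, `nonPhantom_baseChange_of_levelTwoWitness`) consumes the witness OVER `K`.  `stub_transport`
moves it: on the frame (`ρ_{E,2^n}` onto over `ℚ`; `K` imaginary quadratic, `d_K` odd, Heegner for `N`, the two `¬IsSquare` clauses) a `ℚ`-witness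
at `v ∋ N` gives a `K`-witness at any `w₀ ∣ v` (and `2N ∈ w₀`).  Two inputs:
* GLOBAL (`…Lw2PhantomExclusionKLW` §2, `eq_zero_or_eq_resTorsion_of_forall_torsionFixing_pow`): over `K` the non-zero classes of `H¹(K, E[2])`
  dying on `Γ_{K(E[4])}` are EXACTLY `res_K ξ` — `H¹(Gal(K(E[4])/K), E[2]) = {0, res_K ξ}` (LINE 26 card P2/P3 «`res ξ_ℚ = ξ_K`», in the tree's
  currency, from Lawson–Wuthrich's `#H¹ ≤ 2` over `K` and `E(K)[2] = 0`);
* LOCAL (`[K_{w₀} : ℚ_v] = 1`): `v ∋ N` has `e = f = 1` in `K` by the Heegner hypothesis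
  (`ramificationIdx_eq_one_and_inertiaDeg_eq_one_of_natCast_mem_of_satisfiesHeegnerHypothesis`), the local degree is `e·f`
  (`GenusExact.PlusDescent.finrank_adicCompletionMap_eq_ramificationIdx_mul_inertiaDeg`), and at a degree-one completion the Selmer local
  condition descends: `res_K x ∈ 𝓛_{w₀}(E_K) ⟹ x ∈ 𝓛_v(E)` (gk2-p3 `GenusExact.SelmerDescent.mem_selmerLocalKer_of_resTorsion_mem_of_finrank_eq_one`).
`levelTwoWitness_baseChange_of_rat` (§3) is `stub_transport` VERBATIM (its binders `Odd (∏ c_p)` and `[W.IsGloballyMinimal]` are carried, idle).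
With `…KLW` this leaves LINE 26 with the two re-threads `stub_Q3flat` / `stub_Q4flat` and the declared residual.

EXACTNESS (§4–§6).  `(NPh_2)` ⟹ every non-zero class of `H¹(K, E[2])` dying on `Γ_{K(E[4])}` fails the Selmer condition at SOME place over `2N`
(`levelTwoWitness_of_nonPhantom_four`: lift by `ι_{1→2}`); «∀ z ∃ w» ⟹ «∃ w₀ ∀ z» because those classes are the single class `res_K ξ`
(`exists_place_levelTwoWitness_of_forall`); hence ★ `nonPhantom_pow_iff_levelTwoWitness`: **on the frame, `(NPh_M)` for every `M ≥ 1` ⟺ a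
level-2 witness place `w₀ ∋ 2N` exists** (⟸ = `…KLW`).  READING for the planners (no claim about any curve is added): where the level-2 class is
Kummer at every place over `2N` (LINE 26 instrument: the 34 «no witness» cells of slice 1, every frame — Kummer over `ℚ_v` restricts to Kummer over
`K_w`), `(NPh_M)` is FALSE for all `M ≥ 2`, so no `(NPh)`-fed line reaches them.  BSD is NOT proved by any of this.

References: [LawsonWuthrich2016] §3, §4, §7.1, §8; [GrossLMS1991] §1 (Heegner hypothesis), §9; [McCallumLMS1991] §4 Lemma 4.3;
[SerreGaloisCohomology1997] I.§2.4, II.§1.1; [NeukirchANT1999] Ch. II Prop. (8.5).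
-/

set_option autoImplicit false
-- the Theorems namespace of this sub repeats the summit name by design (D-0017 nested layout)
set_option linter.dupNamespace false

noncomputable section

open scoped Classical NumberField

namespace Summit.BirchSwinnertonDyer.BirchSwinnertonDyer.Theorems.GenusExact.Lw2PhantomExclusion

open WeierstrassCurve NumberField Field IsDedekindDomain
open Literature.NumberTheory.EllipticCurves Literature.NumberTheory.GaloisRepresentations
open Summit.BirchSwinnertonDyer.BirchSwinnertonDyer.Theorems.KolyvaginLowerBoundAtTwo (torsionFixing_le_of_dvd)
open Literature.AnabelianGeometry.AbsoluteAnabelian.NeukirchUchidaProof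
  (ramificationIdx_ringOfIntegersRat_eq_int' inertiaDeg_ringOfIntegersRat_eq_int')

variable (W : WeierstrassCurve ℚ) [W.IsElliptic] {K : Type} [Field K] [NumberField K]

/-! ## §1 A place of the Heegner field over a place `v ∋ N` of `ℚ`; its completion has degree one over `ℚ_v` -/

omit [W.IsElliptic] in
/-- A prime `w ∣ v` of `K` over a place `v ∋ N` of ℚ (`N ≠ 0`), containing `N` (every place of ℚ has a prime of `𝓞 K` above it; the
12-line argument of `NonPhantomPow.exists_place_liesOver_of_satisfiesHeegnerHypothesis`, kept local to keep the imports light). [folklore] -/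
theorem exists_place_liesOver_natCast_mem {N : ℕ} (hN : N ≠ 0) {v : HeightOneSpectrum (𝓞 ℚ)} (hNv : ((N : ℕ) : 𝓞 ℚ) ∈ v.asIdeal) :
    ∃ w : HeightOneSpectrum (𝓞 K), w.asIdeal.LiesOver v.asIdeal ∧ ((N : ℕ) : 𝓞 K) ∈ w.asIdeal := by
  haveI : v.asIdeal.IsMaximal := Ideal.IsPrime.isMaximal v.isPrime v.ne_bot
  obtain ⟨Q, hQmax, hQover⟩ := Ideal.exists_maximal_ideal_liesOver_of_isIntegral (R := 𝓞 ℚ) (S := 𝓞 K) v.asIdeal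
  have hNQ : ((N : ℕ) : 𝓞 K) ∈ Q := by
    rw [hQover.over, Ideal.under_def, Ideal.mem_comap, map_natCast] at hNv
    exact hNv
  have hQ0 : Q ≠ ⊥ := by
    intro hQ
    rw [hQ, Ideal.mem_bot, Nat.cast_eq_zero] at hNQ
    exact hN hNQ
  obtain ⟨w, hw⟩ : ∃ w : HeightOneSpectrum (𝓞 K), w.asIdeal = Q := ⟨⟨Q, hQmax.isPrime, hQ0⟩, rfl⟩
  haveI : w.asIdeal.LiesOver v.asIdeal := by rw [hw]; exact hQover
  exact ⟨w, inferInstance, by rw [hw]; exact hNQ⟩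

omit [W.IsElliptic] in
/-- **`[K_w : ℚ_v] = 1` at a place `w ∋ N` of the Heegner field** (`K` imaginary quadratic, Heegner hypothesis for `N ≠ 0`, `w ∣ v`): `e(w) = f(w) = 1`
(`ramificationIdx_eq_one_and_inertiaDeg_eq_one_of_natCast_mem_of_satisfiesHeegnerHypothesis`) and `[K_w : ℚ_v] = e·f`
(`GenusExact.PlusDescent.finrank_adicCompletionMap_eq_ramificationIdx_mul_inertiaDeg`). [cite: GrossLMS1991, §1 (the Heegner hypothesis)]
[cite: NeukirchANT1999, Ch. II Prop. (8.5)] -/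
theorem finrank_adicCompletion_eq_one_of_satisfiesHeegnerHypothesis (hK : IsImaginaryQuadratic K) {N : ℕ} (hN : N ≠ 0)
    (hH : SatisfiesHeegnerHypothesis N K) (v : HeightOneSpectrum (𝓞 ℚ)) (w : HeightOneSpectrum (𝓞 K)) [w.asIdeal.LiesOver v.asIdeal]
    (hNw : ((N : ℕ) : 𝓞 K) ∈ w.asIdeal) :
    letI : Algebra (v.adicCompletion ℚ) (w.adicCompletion K) := (adicCompletionMap (K := ℚ) K v w).toAlgebra
    Module.finrank (v.adicCompletion ℚ) (w.adicCompletion K) = 1 := by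
  haveI : w.asIdeal.IsMaximal := w.isMaximal
  obtain ⟨he, hf⟩ := ramificationIdx_eq_one_and_inertiaDeg_eq_one_of_natCast_mem_of_satisfiesHeegnerHypothesis hK.1 hH hN w hNw
  have h := GenusExact.PlusDescent.finrank_adicCompletionMap_eq_ramificationIdx_mul_inertiaDeg K v w
  rw [← ramificationIdx_ringOfIntegersRat_eq_int', ← inertiaDeg_ringOfIntegersRat_eq_int', he, hf, mul_one] at h
  exact h

/-! ## §2 The witness moves from `ℚ_v` to `K_{w₀}` -/

/-- ★ **A level-`2` witness over `ℚ` at `v` is a level-`2` witness over `K` at any degree-one `w₀ ∣ v`.**  Frame: `ρ_{E,2^n}` onto over `ℚ`, `K`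
imaginary quadratic with `d_K` odd and the two `¬IsSquare` clauses; `w₀ ∣ v` with `[K_{w₀} : ℚ_v] = 1`.  If no non-zero class of `H¹(ℚ, E[2])` dying
on `Γ_{ℚ(E[4])}` is Kummer at `ℚ_v`, then no non-zero class of `H¹(K, E_K[2])` dying on `Γ_{K(E_K[4])}` is Kummer at `K_{w₀}`: such a class is
`res_K ξ` for g10's level-`4` class `ξ` (`…KLW` rigidity `eq_zero_or_eq_resTorsion_of_forall_torsionFixing_pow` at `M = 2`), and at a degree-one
completion `res_K ξ ∈ 𝓛_{w₀} ⟹ ξ ∈ 𝓛_v` (`SelmerDescent.mem_selmerLocalKer_of_resTorsion_mem_of_finrank_eq_one`).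
[cite: LawsonWuthrich2016, §3 (Lemma 6, Thm. 1), §7.1] [cite: McCallumLMS1991, §4 Lemma 4.3] [cite: SerreGaloisCohomology1997, I.§2.4] -/
theorem levelTwoWitness_baseChange_of_finrank_eq_one
    (hρ : ∀ n : ℕ, 0 < n → W.HasSurjectiveModNGaloisRep ((2 : ℤ) ^ n)) (hK : IsImaginaryQuadratic K)
    (hodd : Odd (NumberField.discr K)) (hnsq₁ : ¬ IsSquare ((NumberField.discr K : ℚ) * -|W.Δ|))
    (hnsq₂ : ¬ IsSquare ((NumberField.discr K : ℚ) * (-(2 * |W.Δ|))))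
    (v : HeightOneSpectrum (𝓞 ℚ)) (w₀ : HeightOneSpectrum (𝓞 K)) [w₀.asIdeal.LiesOver v.asIdeal]
    (h1 : letI : Algebra (v.adicCompletion ℚ) (w₀.adicCompletion K) := (adicCompletionMap (K := ℚ) K v w₀).toAlgebra
      Module.finrank (v.adicCompletion ℚ) (w₀.adicCompletion K) = 1)
    (hwit : ∀ z : galH1Torsion W 2, z ≠ 0 → (∀ ρ ∈ torsionFixing W 4, h1Eval W 2 z ρ = 0) →
      z ∉ selmerLocalKer W (v.adicCompletion ℚ) 2) :
    ∀ z : galH1Torsion (W.baseChange K) 2, z ≠ 0 →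
      (∀ ρ ∈ torsionFixing (W.baseChange K) 4, h1Eval (W.baseChange K) 2 z ρ = 0) →
        z ∉ selmerLocalKer (W.baseChange K) (w₀.adicCompletion K) 2 := by
  intro z hz0 hz hzw
  have hsurj4 : W.HasSurjectiveModNGaloisRep 4 := by have h := hρ 2 two_pos; norm_num at h; exact h
  obtain ⟨ξ, hξ0, hξ⟩ := GenusKolyTwistingPrime.exists_ne_zero_forall_torsionFixing_four_h1Eval_eq_zero W hsurj4
  have hz' : ∀ ρ ∈ torsionFixing (W.baseChange K) ((2 ^ 2 : ℕ) : ℤ), h1Eval (W.baseChange K) (2 : ℤ) z ρ = 0 := by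
    have e : ((2 ^ 2 : ℕ) : ℤ) = 4 := by norm_num
    rw [e]
    exact hz
  rcases eq_zero_or_eq_resTorsion_of_forall_torsionFixing_pow W hρ hK hodd hnsq₁ hnsq₂ hξ0 hξ le_rfl hz' with h | h
  · exact hz0 h
  · subst h
    exact hwit ξ hξ0 hξ (SelmerDescent.mem_selmerLocalKer_of_resTorsion_mem_of_finrank_eq_one W K v w₀ (2 : ℤ) h1 hzw)

/-! ## §3 LINE 26 STUB `stub_transport` VERBATIM -/

/-- ★★ **LINE 26 STUB `stub_transport`, VERBATIM: the level-`2` witness moves from a place `v ∣ N` of `ℚ` to a place `w₀ ∣ 2N` of the Heegner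
field.**  On the route's frame (`E/ℚ` globally minimal, `Odd (∏ c_p)`, `ρ_{E,2^n}` onto for all `n ≥ 1`; `K` imaginary quadratic, `d_K` odd, Heegner for
`N`, `d_K·(−|Δ|)` and `d_K·(−2|Δ|)` non-squares): a place `v ∋ N` of `ℚ` at which no non-zero class of `H¹(ℚ, E[2])` dying on `Γ_{ℚ(E[4])}` is Kummer
yields a place `w₀ ∋ 2N` of `K` with the same property over `K` — `w₀` any prime over `v` (`e = f = 1` by the Heegner hypothesis, §1), by §2.  Feeds
`stub_KLW` (`nonPhantom_baseChange_of_levelTwoWitness`); the binders `Odd (∏ c_p)` and `[W.IsGloballyMinimal]` are carried, not used.  BSD is NOT proved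
by this; `OffCutResidualAtTwoR` is NOT closed by it. [cite: LawsonWuthrich2016, §4, §7.1 and §8] [cite: GrossLMS1991, §1 and §9]
[cite: McCallumLMS1991, §4 Lemma 4.3] -/
theorem levelTwoWitness_baseChange_of_rat :
    ∀ (W : WeierstrassCurve ℚ) [W.IsElliptic] [W.IsGloballyMinimal] [NeZero (W.conductorNorm ℤ)],
      Odd W.tamagawaProduct → (∀ n : ℕ, 0 < n → W.HasSurjectiveModNGaloisRep ((2 : ℤ) ^ n)) →
      ∀ (K : Type) [Field K] [NumberField K], IsImaginaryQuadratic K → Odd (NumberField.discr K) →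
        SatisfiesHeegnerHypothesis (W.conductorNorm ℤ) K →
        ¬ IsSquare ((NumberField.discr K : ℚ) * -|W.Δ|) → ¬ IsSquare ((NumberField.discr K : ℚ) * (-(2 * |W.Δ|))) →
        (∃ v : HeightOneSpectrum (𝓞 ℚ), ((W.conductorNorm ℤ : ℕ) : 𝓞 ℚ) ∈ v.asIdeal ∧
          (∀ z : galH1Torsion W 2, z ≠ 0 → (∀ ρ ∈ torsionFixing W 4, h1Eval W 2 z ρ = 0) →
            z ∉ selmerLocalKer W (v.adicCompletion ℚ) 2)) →
        ∃ w₀ : HeightOneSpectrum (𝓞 K), ((2 * W.conductorNorm ℤ : ℕ) : 𝓞 K) ∈ w₀.asIdeal ∧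
          (∀ z : galH1Torsion (W.baseChange K) 2, z ≠ 0 → (∀ ρ ∈ torsionFixing (W.baseChange K) 4, h1Eval (W.baseChange K) 2 z ρ = 0) →
            z ∉ selmerLocalKer (W.baseChange K) (w₀.adicCompletion K) 2) := by
  intro W _ _ _ _hT hρ K _ _ hK hodd hH hnsq₁ hnsq₂ hv
  obtain ⟨v, hNv, hwit⟩ := hv
  have hN : W.conductorNorm ℤ ≠ 0 := NeZero.ne _
  obtain ⟨w₀, hw₀v, hNw₀⟩ := exists_place_liesOver_natCast_mem (K := K) hN hNv
  haveI := hw₀v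
  refine ⟨w₀, ?_, levelTwoWitness_baseChange_of_finrank_eq_one W hρ hK hodd hnsq₁ hnsq₂ v w₀
    (finrank_adicCompletion_eq_one_of_satisfiesHeegnerHypothesis hK hN hH v w₀ hNw₀) hwit⟩
  rw [Nat.cast_mul]
  exact w₀.asIdeal.mul_mem_left _ hNw₀

/-! ## §4 `(NPh_2)` ⟹ the level-2 witness -/

/-- **`(NPh_2)` ⟹ LEVEL-2 WITNESS (place-wise form).**  On the frame, if every class of `H¹(K, E[4])` dying on `Γ_{K(E[4])}` and Kummer at all
places of a set `S` (here: the places over `2N`) is `0`, then every NON-ZERO class of `H¹(K, E[2])` dying on `Γ_{K(E[4])}` fails the Kummer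
condition at SOME place of `S`: its lift `ι_{1→2} z ∈ H¹(K, E[4])` dies on `Γ_{K(E[4])}` (`[ι_* z, ρ] = [z, ρ]`) and would be Kummer everywhere on `S`
(`RelaxedCount.torsionH1OfDvd_mem_selmerLocalKer_iff_mem`), hence `0`, and `ι` is injective (`E(K)[2] = 0`). [cite: LawsonWuthrich2016, §7.1, §8]
[cite: McCallumLMS1991, §4 (5)] -/
theorem levelTwoWitness_of_nonPhantom_four
    (hρ : ∀ n : ℕ, 0 < n → W.HasSurjectiveModNGaloisRep ((2 : ℤ) ^ n)) (hK : IsImaginaryQuadratic K)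
    (S : Set (HeightOneSpectrum (𝓞 K)))
    (hNPh2 : ∀ z : galH1Torsion (W.baseChange K) ((2 ^ 2 : ℕ) : ℤ),
      (∀ ρ ∈ torsionFixing (W.baseChange K) ((2 ^ 2 : ℕ) : ℤ), h1Eval (W.baseChange K) ((2 ^ 2 : ℕ) : ℤ) z ρ = 0) →
      (∀ w ∈ S, z ∈ selmerLocalKer (W.baseChange K) (w.adicCompletion K) ((2 ^ 2 : ℕ) : ℤ)) → z = 0)
    {z : galH1Torsion (W.baseChange K) (2 : ℤ)} (hz0 : z ≠ 0)
    (hz : ∀ ρ ∈ torsionFixing (W.baseChange K) (4 : ℤ), h1Eval (W.baseChange K) (2 : ℤ) z ρ = 0) :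
    ∃ w ∈ S, z ∉ selmerLocalKer (W.baseChange K) (w.adicCompletion K) (2 : ℤ) := by
  haveI : (W.baseChange K).IsElliptic := inferInstanceAs (W.map (algebraMap ℚ K)).IsElliptic
  have h12 : (2 : ℤ) ∣ ((2 ^ 2 : ℕ) : ℤ) := ⟨2, by norm_num⟩
  have hinj : Function.Injective (torsionH1OfDvd (W.baseChange K) h12) :=
    VisiblePairAtTwo.torsionH1OfDvd_pow_injective (W.baseChange K) (p := 2) (a := 1) (j := 2)
      (torsionBy_two_baseChange_eq_bot_natCast W hρ hK) _
  by_contra hall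
  push Not at hall
  have hz4 : ∀ ρ ∈ torsionFixing (W.baseChange K) ((2 ^ 2 : ℕ) : ℤ), h1Eval (W.baseChange K) (2 : ℤ) z ρ = 0 := by
    have e : ((2 ^ 2 : ℕ) : ℤ) = 4 := by norm_num
    rw [e]
    exact hz
  have hι0 : torsionH1OfDvd (W.baseChange K) h12 z = 0 :=
    hNPh2 _ (fun ρ hρ' ↦ (h1Eval_torsionH1OfDvd_eq_zero_iff (W.baseChange K) h12 z hρ').mpr (hz4 ρ hρ'))
      (fun w hw ↦ (RelaxedCount.torsionH1OfDvd_mem_selmerLocalKer_iff_mem (W.baseChange K) h12 (w.adicCompletion K) z).mpr (hall w hw))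
  exact hz0 (hinj (by rw [hι0, map_zero]))

/-! ## §5 «∀ z ∃ w» ⟹ «∃ w₀ ∀ z»: one place serves every class -/

/-- **One witness place serves all classes.**  On the frame, if every non-zero class of `H¹(K, E[2])` dying on `Γ_{K(E[4])}` fails the Kummer
condition at some place of a set `S`, then there is ONE place `w₀ ∈ S` at which all of them fail: by the rigidity of `…KLW`
(`eq_zero_or_eq_resTorsion_of_forall_torsionFixing_pow` at `M = 2`) those classes are the single class `res_K ξ`, `ξ` g10's level-`4` class.
[cite: LawsonWuthrich2016, §3 (Lemma 6, Thm. 1), §7.1] -/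
theorem exists_place_levelTwoWitness_of_forall
    (hρ : ∀ n : ℕ, 0 < n → W.HasSurjectiveModNGaloisRep ((2 : ℤ) ^ n)) (hK : IsImaginaryQuadratic K)
    (hodd : Odd (NumberField.discr K)) (hnsq₁ : ¬ IsSquare ((NumberField.discr K : ℚ) * -|W.Δ|))
    (hnsq₂ : ¬ IsSquare ((NumberField.discr K : ℚ) * (-(2 * |W.Δ|))))
    (S : Set (HeightOneSpectrum (𝓞 K)))
    (hwit : ∀ z : galH1Torsion (W.baseChange K) (2 : ℤ), z ≠ 0 →
      (∀ ρ ∈ torsionFixing (W.baseChange K) (4 : ℤ), h1Eval (W.baseChange K) (2 : ℤ) z ρ = 0) →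
        ∃ w ∈ S, z ∉ selmerLocalKer (W.baseChange K) (w.adicCompletion K) (2 : ℤ)) :
    ∃ w₀ ∈ S, ∀ z : galH1Torsion (W.baseChange K) 2, z ≠ 0 →
      (∀ ρ ∈ torsionFixing (W.baseChange K) 4, h1Eval (W.baseChange K) 2 z ρ = 0) →
        z ∉ selmerLocalKer (W.baseChange K) (w₀.adicCompletion K) 2 := by
  have hsurj4 : W.HasSurjectiveModNGaloisRep 4 := by have h := hρ 2 two_pos; norm_num at h; exact h
  obtain ⟨ξ, hξ0, hξ⟩ := GenusKolyTwistingPrime.exists_ne_zero_forall_torsionFixing_four_h1Eval_eq_zero W hsurj4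
  obtain ⟨ha0, ha⟩ := resTorsion_ne_zero_and_forall_torsionFixing_four W hρ hK hξ0 hξ
  obtain ⟨w₀, hw₀S, hw₀⟩ := hwit _ ha0 ha
  refine ⟨w₀, hw₀S, fun z hz0 hz hzw ↦ ?_⟩
  have hz4 : ∀ ρ ∈ torsionFixing (W.baseChange K) ((2 ^ 2 : ℕ) : ℤ), h1Eval (W.baseChange K) (2 : ℤ) z ρ = 0 := by
    have e : ((2 ^ 2 : ℕ) : ℤ) = 4 := by norm_num
    rw [e]
    exact hz
  rcases eq_zero_or_eq_resTorsion_of_forall_torsionFixing_pow W hρ hK hodd hnsq₁ hnsq₂ hξ0 hξ le_rfl hz4 with h | h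
  · exact hz0 h
  · exact hw₀ (h ▸ hzw)

/-! ## §6 The equivalence -/

/-- ★ **THE LEVER IS EXACT: `(NPh_M)` for every `M ≥ 1` ⟺ a level-2 witness place over `2N` exists.**  On the route's frame (`ρ_{E,2^n}` onto over
`ℚ` for all `n`; `K` imaginary quadratic, `d_K` odd, `d_K·(−|Δ|)`, `d_K·(−2|Δ|)` non-squares; any `N`): (⟸) is `…KLW`
(`eq_zero_pow_of_levelTwoWitness`); (⟹) is `(NPh_2)` ⟹ witness (§4) made uniform in the place (§5).
READING: where the level-2 class is Kummer at every place over `2N` (LINE 26's «no witness» cells, every frame), `(NPh_M)` FAILS for all `M ≥ 2`.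
BSD is NOT proved by this. [cite: LawsonWuthrich2016, §3, §7.1 and §8] [cite: GrossLMS1991, §9 Prop. 9.1] [cite: McCallumLMS1991, §4 (5), Lemma 4.6] -/
theorem nonPhantom_pow_iff_levelTwoWitness
    (hρ : ∀ n : ℕ, 0 < n → W.HasSurjectiveModNGaloisRep ((2 : ℤ) ^ n)) (hK : IsImaginaryQuadratic K)
    (hodd : Odd (NumberField.discr K)) (hnsq₁ : ¬ IsSquare ((NumberField.discr K : ℚ) * -|W.Δ|))
    (hnsq₂ : ¬ IsSquare ((NumberField.discr K : ℚ) * (-(2 * |W.Δ|)))) (N : ℕ) :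
    (∀ (Mlev : ℕ), 1 ≤ Mlev → ∀ z : galH1Torsion (W.baseChange K) ((2 ^ Mlev : ℕ) : ℤ),
        (∀ ρ ∈ torsionFixing (W.baseChange K) ((2 ^ Mlev : ℕ) : ℤ), h1Eval (W.baseChange K) ((2 ^ Mlev : ℕ) : ℤ) z ρ = 0) →
        (∀ w : HeightOneSpectrum (𝓞 K), ((2 * N : ℕ) : 𝓞 K) ∈ w.asIdeal →
          z ∈ selmerLocalKer (W.baseChange K) (w.adicCompletion K) ((2 ^ Mlev : ℕ) : ℤ)) → z = 0) ↔
      ∃ w₀ : HeightOneSpectrum (𝓞 K), ((2 * N : ℕ) : 𝓞 K) ∈ w₀.asIdeal ∧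
        ∀ z : galH1Torsion (W.baseChange K) 2, z ≠ 0 →
          (∀ ρ ∈ torsionFixing (W.baseChange K) 4, h1Eval (W.baseChange K) 2 z ρ = 0) →
            z ∉ selmerLocalKer (W.baseChange K) (w₀.adicCompletion K) 2 := by
  set S : Set (HeightOneSpectrum (𝓞 K)) := {w | ((2 * N : ℕ) : 𝓞 K) ∈ w.asIdeal}
  constructor
  · intro hNPh
    obtain ⟨w₀, hw₀S, hw₀⟩ := exists_place_levelTwoWitness_of_forall W hρ hK hodd hnsq₁ hnsq₂ S
      (fun z hz0 hz ↦ levelTwoWitness_of_nonPhantom_four W hρ hK S (hNPh 2 (by norm_num)) hz0 hz)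
    exact ⟨w₀, hw₀S, hw₀⟩
  · rintro ⟨w₀, hw₀, hwit⟩ Mlev hM z hz hw
    exact eq_zero_pow_of_levelTwoWitness W hρ hK hodd hnsq₁ hnsq₂ hwit hM le_rfl z hz (hw w₀ hw₀)

end Summit.BirchSwinnertonDyer.BirchSwinnertonDyer.Theorems.GenusExact.Lw2PhantomExclusion

end
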